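/-
Origin: expansion seat `planner-pub-hodgecm-mc-unitary-1-g5-0`, handover #1 r3 2026-08-19T15:45:01Z md5 8d00ccf342cf (289 l.; NEW additive leaf, RUN 36; node W2-Kn «K-norm» PKG hand = gen-4 draft of record 1fb3049d3201 re-headed + gen-5 `Signs` section (frameD_sign_ι₁ / frameD_pos_of_ne read off HermSpace3 via twin LinearAlgebra.Matrix.HermitianCongruenceInertia #K248 + J-Syl `sylvesterFrame_spec'`) + wmInputCM₂s' ; r2 = ruling (J-x₀) model1-g6 11:03:25Z: §Frame = reducible ALIASES frameG := HermSpace3.rationalFrame V, frameD := HermSpace3.rationalFrame_d V (+ frameD_real / frameD_ne / frame_congr := glue-1's rationalFrame_d_conj / _d_ne_zero / rationalFrame_diag) — INSTALL AFTER glue-1 #338 `Model/Junction/RationalFrame.lean` f902af78bd73 (t36-mcglue1g5.txt); decls wmInputCM₂ / wmInputCM₂_ρ / wmInputCM₂_SK / wmOf₂ / wmInputCM₂b / wmInputCM₂b_ρ / wmOf₂b / wmInputCM₂b_center / wmInputCM₂s / wmInputCM₂s' + Frame aliases / dW helpers; other imports: WmInstance, Model.Junction.SylvesterFrame (either body: used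 only via `_spec'`), K-1 v19 twin HermitianCongruenceInertia #K248 (installed RUN 35) and the THREE P-76.1-DROPPED twins CMTwistKType #K185 / CMTwistDet #K188 / Weil1964.ArchDualPairThetaMajorants #K247 — see # PREREQUISITES; 0 records, no placeholder proof, kernel only) (`HOME/mc/pub-hodgecm-mc-unitary-1-g5/work/pkg/HodgeCM/Model/WmInstanceV2.lean`, md5 8d00ccf3, 289 lines);
landed by the gen-12 packager (p-g12) in gate run 36 as `HodgeCM/Model/WmInstanceV2.lean` (stripped 7 trailing import-line comments).
-/
/-
Origin: speedrun cell pub-hodgecm, MODEL-CONSTRUCTION sub-cell, lineage mc-unitary-1 (node W2-Kn «K-norm», MODEL-DAG §1),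
seat planner-pub-hodgecm-mc-unitary-1-g5-0 (gen 5), 2026-08-19.  Text = gen 4's draft of record (seat …-g4-0; tree-side shadow
`HOME/mc/pub-hodgecm-mc-unitary-1-g4/work/shadow_v2_combined.lean` rc 0, no placeholder proof) + gen 5's `Signs` section and `wmInputCM₂s'`;
`dW` helpers: gen 3's v1 draft, verbatim; Frame section = ALIASES of the rational frame of record `HermSpace3.rationalFrame`
(`HodgeCM.Model.Junction.RationalFrame`, glue-1 kit #338) per ruling (J-x₀) model1-g6 2026-08-19T11:03:25Z (r2 of this row).
Target in PKG: `HodgeCM/Model/WmInstanceV2.lean` (NEW additive leaf, RUN 36; nothing imports it until node E / binder-2's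
`Model/HypCensus/*` / the TERM-form sibling `HodgeCM/Model/WmInstanceV2Term.lean` do).  KERNEL only: 0 records / named facts,
no placeholder proof; every field of the record is a NAMED TREE TERM (vendored verbatim under `HodgeCM.Vendored.H21.*`, namespaces unchanged).
IMPORTS: every tree twin below is installed in the package since gate RUN 35 (K-1 v19, p-g11 CUT A 2026-08-19T10:18Z);
`Model.Junction.RationalFrame` is glue-1's RUN-36 row #338 (install it BEFORE this file); `Model.Junction.SylvesterFrame` (run 32,
body replaced by #339 — used here only through `sylvesterFrame_spec'`) and `LinearAlgebra.Matrix.HermitianCongruenceInertia` (K-1 v19)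
serve the `Signs` section only.
CERTIFICATE: elaborated by this seat against the RUN-35 package oleans (local `lean` with the package's LEAN_PATH, no `lake` in PKG),
rc 0, no placeholder proof, `#print axioms` of every `def` below ⊆ {propext, Classical.choice, Quot.sound} — log + cert under
`HOME/mc/pub-hodgecm-mc-unitary-1-g5/farm/`.

WHAT THIS FILE IS.  `wm V c` v2 = v0 `wmOf' hP (W : WmInput V S)` (HodgeCM/Model/WmInstance.lean) at the bundled input
  W := wmInputCM₂b V S hGR hρ χV χW hδ τ T hT            -- E-facing block of record ((χ′-final) 06:44:01Z; `hβ` OUT for good 09:01:12Z, model1-g5)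
     | wmInputCM₂t V S hGR hρ nV nW hδ τ T hT             -- TERM form (binder-2's interface) — in the sibling leaf `WmInstanceV2Term.lean`
     | wmInputCM₂s V S hGR χV χW h₁V h₁W hV hδ τ T hT      -- `hρ` discharged from sign facts (weil-2 `…_of_signs_two`)
     | wmInputCM₂s' V S hGR χV χW h₁W hδ τ T hT           -- idem, `h₁V`/`hV` READ OFF `HermSpace3` (gen 5 `Signs`); only `h₁W` (W definite at ι₁) left
with, field by field (all tree, GelbartRogawski1991/UnitaryDualPairThetaKernelCM{,KType,Twist,TwistKType,TwistDet}):
  ρ    := (cmPairRepTwist L e dV … hGR η).toHomUnits,  η := cmDetTwistChar … (χ_V∘det) ⊠ (χ_W∘det)   [GR91 §3.1 Remark p.457 L9–13]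
  hρ   := hasThetaMajorants_cmPairRepTwist … hρ hηc                                                 [Weil1964 n° 41 Thm 6 p.193]
  hrat := cmPairRepTwist_toHomUnits_mem_thetaStabilizer … hη  (η ≡ 1 on rational points: `…_eq_one_of_unitaryLineChar`)
  SK   := cmKTypeTwist … (UnitaryGroup.archKappa (L : Type) V.Hm τ T hT),  SK_stable := cmKTypeTwist_stable …
  eV   := cmFrameEquiv (THE rational frame of record `V.rationalFrame`, (J-x₀)/(P2)),  eW := cmAdelicEquiv.
ACCEPTANCE TEST (Z⁻ = {(u·1_V, u⁻¹·1_W)}): `wmInputCM₂b_center` — the W-action on the anti-diagonal centre is the scalar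
`β u` whenever `χV (u^3) * χW (u⁻¹^2) = β u` (value half vs Kudla's β [HKS96 (1.14)–(1.15) p.952] = binder-2's archimedean read-off).
A Sylvester frame for the binders `τ T hT` at `τ := ι₁` is the package's own `V.sylvesterFrame` / `V.sylvesterFrame_spec` (J-Syl).
-/
import Summits.HodgeConjecture.HodgeCM.Model.WmInstance
import Summits.HodgeConjecture.HodgeCM.Model.Junction.RationalFrame
import Summits.HodgeConjecture.HodgeCM.Model.Junction.SylvesterFrame
import Literature.LinearAlgebra.Matrix.HermitianCongruenceInertia
import Literature.NumberTheory.GelbartRogawski1991.UnitaryDualPairThetaKernelCMTwistKType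
import Literature.NumberTheory.GelbartRogawski1991.UnitaryDualPairThetaKernelCMTwistDet
import Literature.NumberTheory.Weil1964.ArchDualPairThetaMajorants

-- G11b-3 recipe (port D30 slow-export class; ops-buildfix LEDGER B13-1/B13-3): elaborate sequentially so the trailing
-- `attribute [implicit_reducible]` block (reducibilityCoreExt is keyed to the async environment branch) is in force at `.olean` export.
set_option Elab.async false

noncomputable section

namespace HodgeCM.Model

open HodgeCM.Adelic Literature.NumberTheory.Weil1964 Literature.NumberTheory.Automorphic NumberField
open Literature.NumberTheory.GelbartRogawski1991.UnitaryDualPair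
open Literature.RepresentationTheory.HeisenbergGroup
open scoped Matrix

variable {L : CMField} {ι₁ : L →+* ℂ}

section Frame
/-! ### the rational orthogonal frame OF RECORD — ruling (J-x₀) model1-g6 2026-08-19T11:03:25Z: ONE name,
`HermSpace3.rationalFrame V` / `rationalFrame_d V` of `HodgeCM.Model.Junction.RationalFrame` (glue-1, kit #338; chosen once from
(P2) `HermSpace3.exists_rational_frame`, kernel).  The five names below are REDUCIBLE ALIASES kept so that §V2/§V2c/§Signs and
binder-2's `HypCensus/*` drafts (which say `frameG`) compile unchanged: `frameG V` IS `V.rationalFrame` (`abbrev`, `rfl`), not a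
second choice.  With these, E quantifies its print binder `hGR` over all `V, c` uniformly, at the torus-fixed base point `x₀`. -/

variable (V : HermSpace3 L ι₁)

/-- the rational frame `g ∈ GL₃(L)` of record (= `HermSpace3.rationalFrame V`). -/
abbrev frameG : GL (Fin 3) L := HermSpace3.rationalFrame V
/-- its diagonal entries `d` (= `HermSpace3.rationalFrame_d V`; `σ dᵢ = dᵢ ≠ 0`). -/
abbrev frameD : Fin 3 → L := HermSpace3.rationalFrame_d V
/-- (Ported verbatim from the HodgeCMPerL package; no docstring in the source.) -/
theorem frameD_real : ∀ i, IsCMField.complexConj L (frameD V i) = frameD V i :=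
  HermSpace3.rationalFrame_d_conj V                                    -- `conjRingHomK L x = complexConj L x` rfl
/-- (Ported verbatim from the HodgeCMPerL package; no docstring in the source.) -/
theorem frameD_ne : ∀ i, frameD V i ≠ 0 := HermSpace3.rationalFrame_d_ne_zero V
/-- `ᵗ(σ g) · V.Hm · g = diagonal d` in the TREE shape `(g.map (cmConjRingHom L))ᵀ * H * g` expected by `cmFrameEquiv`
(`rationalFrame_diag` gives `gᵀ.map (conjRingHomK L) * …`; `Mᵀ.map f = (M.map f)ᵀ` and `conjRingHomK = cmConjRingHom` are `rfl`). -/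
theorem frame_congr : (((frameG V : GL (Fin 3) L) : Matrix (Fin 3) (Fin 3) L).map (cmConjRingHom L))ᵀ * V.Hm *
    ((frameG V : GL (Fin 3) L) : Matrix (Fin 3) (Fin 3) L) = Matrix.diagonal (frameD V) :=
  HermSpace3.rationalFrame_diag V

end Frame

section Signs
/-! ### sign facts of the chosen rational frame, READ OFF the `HermSpace3` fields `signature_ι₁` / `posDef_of_ne` (gen 5)
Sylvester's law of inertia — kernel, twin `HodgeCM.Vendored.H21.LinearAlgebra.Matrix.HermitianCongruenceInertia`
[HornJohnson2013 §4.5 Thm 4.5.8] — applied to the rational frame `(frameG, frameD)` and the package's Sylvester frame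
`HermSpace3.sylvesterFrame` (J-Syl).  These discharge the binders `h₁V`, `hV` of `wmInputCM₂s`.  `h₁W` — definiteness of
`W = ⟨a₀, a₁⟩` at `ι₁` — is a condition on the seesaw datum, not on `V`, and stays a binder: it holds under `GoodCtx`, but
`GoodCtx` is a predicate of the model built FROM `W`, so it cannot be consumed inside `W`. -/

variable (V : HermSpace3 L ι₁)

/-- signature `(2,1)` at `ι₁`, read on the rational frame: exactly one `ι₁ (d i₀)` is negative, the other two positive. -/
theorem frameD_sign_ι₁ :
    ∃ i₀ : Fin 3, (ι₁ (frameD V i₀)).re < 0 ∧ ∀ i, i ≠ i₀ → 0 < (ι₁ (frameD V i)).re :=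
  Literature.LinearAlgebra.Matrix.exists_re_neg_of_frame_signature_units ι₁ (cmConjRingHom L)
    (embedding_cmConjRingHom (L : Type) ι₁) V.Hm V.sylvesterFrame V.sylvesterFrame_spec' (frameG V) (frameD V)
    (frameD_real V) (frame_congr V)

/-- the same in the shape consumed by `Weil1964.hasThetaMajorants_cmPairSplitting_of_signs_two` (`h₁V`). -/
theorem frameD_sign_ι₁' :
    ∃ i₀ : Fin 3, (∀ i, i ≠ i₀ → 0 < (ι₁ (frameD V i)).re) ∨ ∀ i, i ≠ i₀ → (ι₁ (frameD V i)).re < 0 := by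
  obtain ⟨i₀, -, h⟩ := frameD_sign_ι₁ V
  exact ⟨i₀, Or.inl h⟩

/-- definiteness off the place of `ι₁`, read on the rational frame: every `τ (d i)` is positive. -/
theorem frameD_pos_of_ne (τ : L →+* ℂ) (hτ : NumberField.InfinitePlace.mk τ ≠ NumberField.InfinitePlace.mk ι₁)
    (i : Fin 3) : 0 < (τ (frameD V i)).re :=
  Literature.LinearAlgebra.Matrix.re_pos_of_frame_posDef_units τ (cmConjRingHom L) (embedding_cmConjRingHom (L : Type) τ)
    V.Hm (V.posDef_of_ne τ hτ) (frameG V) (frameD V) (frame_congr V) i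

/-- the same in the shape consumed by `Weil1964.hasThetaMajorants_cmPairSplitting_of_signs_two` (`hV`). -/
theorem frameD_sign_of_ne (τ : L →+* ℂ) (hτ : NumberField.InfinitePlace.mk τ ≠ NumberField.InfinitePlace.mk ι₁) :
    (∀ i, 0 < (τ (frameD V i)).re) ∨ ∀ i, (τ (frameD V i)).re < 0 :=
  Or.inl (frameD_pos_of_ne V τ hτ)

end Signs

/-- the W-side discriminants `(a₀, a₁)` of the seesaw datum. -/
def dW (S : StubTree.SeesawDatum L) : Fin 2 → L := ![S.a 0, S.a 1]

/-- (Ported verbatim from the HodgeCMPerL package; no docstring in the source.) -/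
theorem dW_real (S : StubTree.SeesawDatum L) : ∀ i, IsCMField.complexConj L (dW S i) = dW S i := by
  intro i; fin_cases i <;> exact S.a_real _      -- `conjRingHomK L x = IsCMField.complexConj L x` is `rfl`

/-- (Ported verbatim from the HodgeCMPerL package; no docstring in the source.) -/
theorem dW_ne (S : StubTree.SeesawDatum L) : ∀ i, dW S i ≠ 0 := by
  intro i; fin_cases i <;> exact S.a_ne _

/-- (Ported verbatim from the HodgeCMPerL package; no docstring in the source.) -/
theorem diagonal_dW (S : StubTree.SeesawDatum L) : Matrix.diagonal (dW S) = Matrix.diagonal ![S.a 0, S.a 1] := rfl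

section V2

variable (hP : PrintFact_unitaryCompact) (V : HermSpace3 L ι₁) (S : StubTree.SeesawDatum L)

variable
  (hGR : (cmSplittingDatum (L : Type) finProdFinEquiv (frameD V) (frameD_real V) (frameD_ne V) (dW S) (dW_real S) (dW_ne S)).CompatibleSplitting)
  (hρ : HasThetaMajorants fun (p : CMAdelic (L : Type) (frameD V) × CMAdelic (L : Type) (dW S)) (Φ : CMSchwartz (L : Type) 6) =>
      adelicMpCont.omega (↥(maximalRealSubfield L)) (Fin 6)
        (CMGram (L : Type) finProdFinEquiv (frameD V) (frameD_real V) (dW S) (dW_real S))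
        (cmPairSplitting (L : Type) finProdFinEquiv (frameD V) (frameD_real V) (frameD_ne V) (dW S) (dW_real S) (dW_ne S) hGR p) Φ)
  (η : CMAdelic (L : Type) (frameD V) × CMAdelic (L : Type) (dW S) →* ℂˣ)
  (hη : ∀ γU ∈ CMRat (L : Type) (frameD V), ∀ γ ∈ CMRat (L : Type) (dW S), η (γU, γ) = 1)
  (hηc : Continuous fun p => ((η p : ℂˣ) : ℂ))

/-- **the bundled input record of `wm V c`, v2 (K-norm)**. -/
def wmInputCM₂ (_hδ : 0 < (ι₁ (imagUnit L)).im) (τ : L →+* ℂ) (T : GL (Fin 3) ℂ)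
    (hT : formCongr (starRingEnd ℂ) T (V.Hm.map τ) = Literature.Geometry.ComplexHyperbolic.BallModel.J) : WmInput V S where
  F := ↥(maximalRealSubfield L)
  ι := Fin 6
  GU := CMAdelic (L : Type) (frameD V)
  ΓU := CMRat (L : Type) (frameD V)
  G := CMAdelic (L : Type) (dW S)
  Γ := CMRat (L : Type) (dW S)
  ρ := (cmPairRepTwist (L : Type) finProdFinEquiv (frameD V) (frameD_real V) (frameD_ne V) (dW S) (dW_real S) (dW_ne S) hGR η).toHomUnits
  hρ := hasThetaMajorants_cmPairRepTwist (L : Type) finProdFinEquiv (frameD V) (frameD_real V) (frameD_ne V) (dW S) (dW_real S) (dW_ne S) hGR η hρ hηc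
  hrat := fun _ hU _ hγ =>
    cmPairRepTwist_toHomUnits_mem_thetaStabilizer (L : Type) finProdFinEquiv (frameD V) (frameD_real V) (frameD_ne V) (dW S) (dW_real S) (dW_ne S)
      hGR η hη hU hγ
  SK := (cmKTypeTwist (L : Type) finProdFinEquiv (frameD V) (frameD_real V) (frameD_ne V) (dW S) (dW_real S) (dW_ne S) hGR η V.Hm (frameG V) (frame_congr V) τ T hT
          (UnitaryGroup.archKappa (L : Type) V.Hm τ T hT) : Set (CMSchwartz (L : Type) 6))
  SK_stable := cmKTypeTwist_stable (L : Type) finProdFinEquiv (frameD V) (frameD_real V) (frameD_ne V) (dW S) (dW_real S) (dW_ne S) hGR η V.Hm (frameG V) (frame_congr V) τ T hT _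
  SK_zero := (cmKTypeTwist (L : Type) finProdFinEquiv (frameD V) (frameD_real V) (frameD_ne V) (dW S) (dW_real S) (dW_ne S) hGR η V.Hm (frameG V) (frame_congr V) τ T hT _).zero_mem
  SK_add := fun hΦ hΨ =>
    (cmKTypeTwist (L : Type) finProdFinEquiv (frameD V) (frameD_real V) (frameD_ne V) (dW S) (dW_real S) (dW_ne S) hGR η V.Hm (frameG V) (frame_congr V) τ T hT _).add_mem hΦ hΨ
  SK_smul := fun a _ hΦ =>
    (cmKTypeTwist (L : Type) finProdFinEquiv (frameD V) (frameD_real V) (frameD_ne V) (dW S) (dW_real S) (dW_ne S) hGR η V.Hm (frameG V) (frame_congr V) τ T hT _).smul_mem a hΦ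
  eV := (cmFrameEquiv (L : Type) (frameG V) V.Hm (frameD V) (frame_congr V)).toMonoidHom
  heV := continuous_cmFrameEquiv (L : Type) (frameG V) V.Hm (frameD V) (frame_congr V)
  hΓV := fun _ h => cmFrameEquiv_mem_range_toAdelic (L : Type) (frameG V) V.Hm (frameD V) (frame_congr V) h
  eW := (cmAdelicEquiv (L : Type) 2 (Matrix.diagonal (dW S))).toMonoidHom
  heW := (cmAdelicEquiv (L : Type) 2 (Matrix.diagonal (dW S))).continuous
  hΓW := fun _ h => cmAdelicEquiv_mem_range_toAdelic (L : Type) 2 (Matrix.diagonal (dW S)) h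

/-- the `ρ` field of v2 is the normalised Weil action `(ω_ψ ∘ (s_pair ⊗ η)).toHomUnits` (definitional; the W2-⊗ /
census junction socket: peel `η` with `cmPairRepTwist_apply_eq_smul`, then `cmPairRep` = `ω ∘ pairSplitting … (splittingOf hGR)` by `rfl`). -/
theorem wmInputCM₂_ρ (hδ : 0 < (ι₁ (imagUnit L)).im) (τ : L →+* ℂ) (T : GL (Fin 3) ℂ)
    (hT : formCongr (starRingEnd ℂ) T (V.Hm.map τ) = Literature.Geometry.ComplexHyperbolic.BallModel.J) :
    (wmInputCM₂ V S hGR hρ η hη hηc hδ τ T hT).ρ =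
      (cmPairRepTwist (L : Type) finProdFinEquiv (frameD V) (frameD_real V) (frameD_ne V) (dW S) (dW_real S) (dW_ne S) hGR η).toHomUnits := rfl

/-- the `SK` field of v2 is the twisted `κ`-isotypic `K`-type (definitional). -/
theorem wmInputCM₂_SK (hδ : 0 < (ι₁ (imagUnit L)).im) (τ : L →+* ℂ) (T : GL (Fin 3) ℂ)
    (hT : formCongr (starRingEnd ℂ) T (V.Hm.map τ) = Literature.Geometry.ComplexHyperbolic.BallModel.J) :
    (wmInputCM₂ V S hGR hρ η hη hηc hδ τ T hT).SK =
      (cmKTypeTwist (L : Type) finProdFinEquiv (frameD V) (frameD_real V) (frameD_ne V) (dW S) (dW_real S) (dW_ne S) hGR η V.Hm (frameG V) (frame_congr V) τ T hT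
          (UnitaryGroup.archKappa (L : Type) V.Hm τ T hT) : Set (CMSchwartz (L : Type) 6)) := rfl

/-- **`wm V c` v2** = `wmOf' hP (wmInputCM₂ …)`. -/
def wmOf₂ (hδ : 0 < (ι₁ (imagUnit L)).im) (τ : L →+* ℂ) (T : GL (Fin 3) ℂ)
    (hT : formCongr (starRingEnd ℂ) T (V.Hm.map τ) = Literature.Geometry.ComplexHyperbolic.BallModel.J) :
    WeilThetaModel (V.latticeModel hP).toQuotientModel.G (V.latticeModel hP).toQuotientModel.Γ
      (S.latticeModelW hP).toQuotientModel.G (S.latticeModelW hP).toQuotientModel.Γ :=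
  wmOf' hP (wmInputCM₂ V S hGR hρ η hη hηc hδ τ T hT)

/- expected rfl API (from `wmOf'_*` + (J-CMη)): `wmOf₂_W_act p Φ = η p • cmPairRep … p Φ` (`cmPairRepTwist_apply_eq_smul`),
   `wmOf₂_θ_mk : … .θ Φ (x, y) = thetaDistLM L⁺ (Fin 6) (cmPairRepTwist … η ((cmFrameEquiv … x)⁻¹, (cmAdelicEquiv … y)⁻¹) Φ)`,
   and on the anti-diagonal centre `ρ (CMCenter L dV u, CMCenter L (dW S) u⁻¹) Φ = η(…) • Φ` (`cmPairRepTwist_center`). -/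

end V2

/-! ## V2c — E-FACING BLOCK OF RECORD after (W2-Kn-χ′) 06:07:55Z + (χ′-final) 06:44:01Z (model1-g5):
`(χV χW : ContinuousMonoidHom (relNormOneIdeles L⁺ L ⧸ relNormOneRat L⁺ L) Circle)` DATA `+ hδ`
(`hχ`/`hc` discharged BY CURRENCY via (J-CMη-det) §4; `h∞V`/`h∞W : HasArchType …` are binder-2's census binders,
not consumed here; `hβ` OUT). TERM form = preferred end state: χ chosen from the tree existence theorem. -/

section V2c

variable (hP : PrintFact_unitaryCompact) (V : HermSpace3 L ι₁) (S : StubTree.SeesawDatum L)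

variable
  (hGR : (cmSplittingDatum (L : Type) finProdFinEquiv (frameD V) (frameD_real V) (frameD_ne V) (dW S) (dW_real S) (dW_ne S)).CompatibleSplitting)
  (hρ : HasThetaMajorants fun (p : CMAdelic (L : Type) (frameD V) × CMAdelic (L : Type) (dW S)) (Φ : CMSchwartz (L : Type) 6) =>
      adelicMpCont.omega (↥(maximalRealSubfield L)) (Fin 6)
        (CMGram (L : Type) finProdFinEquiv (frameD V) (frameD_real V) (dW S) (dW_real S))
        (cmPairSplitting (L : Type) finProdFinEquiv (frameD V) (frameD_real V) (frameD_ne V) (dW S) (dW_real S) (dW_ne S) hGR p) Φ)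
  (χV χW : ContinuousMonoidHom (relNormOneIdeles (maximalRealSubfield (L : Type)) (L : Type) ⧸ relNormOneRat (maximalRealSubfield (L : Type)) (L : Type)) Circle)

/-- **`wmInputCM` v2, E-facing block of record** ((χ′-final)): χ_V, χ_W in the `[U(1)]`-quotient currency of the
tree existence theorem; automorphy / continuity of `η = (χ_V∘det) ⊠ (χ_W∘det)` hold by typing. -/
def wmInputCM₂b (hδ : 0 < (ι₁ (imagUnit L)).im) (τ : L →+* ℂ) (T : GL (Fin 3) ℂ)
    (hT : formCongr (starRingEnd ℂ) T (V.Hm.map τ) = Literature.Geometry.ComplexHyperbolic.BallModel.J) : WmInput V S :=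
  wmInputCM₂ V S hGR hρ
    (cmDetTwistChar (L : Type) (frameD V) (frameD_ne V) (dW S) (dW_ne S)
      (charOfUnitaryLineChar (L : Type) χV) (charOfUnitaryLineChar (L : Type) χW))
    (cmDetTwistChar_eq_one_of_unitaryLineChar (L : Type) (frameD V) (frameD_ne V) (dW S) (dW_ne S) χV χW)
    (continuous_cmDetTwistChar_of_unitaryLineChar (L : Type) (frameD V) (frameD_ne V) (dW S) (dW_ne S) χV χW) hδ τ T hT

/-- the `ρ` field of the block of record: the `(χ_V ∘ det) ⊠ (χ_W ∘ det)`-normalised Weil action (definitional). -/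
theorem wmInputCM₂b_ρ (hδ : 0 < (ι₁ (imagUnit L)).im) (τ : L →+* ℂ) (T : GL (Fin 3) ℂ)
    (hT : formCongr (starRingEnd ℂ) T (V.Hm.map τ) = Literature.Geometry.ComplexHyperbolic.BallModel.J) :
    (wmInputCM₂b V S hGR hρ χV χW hδ τ T hT).ρ =
      (cmPairRepTwist (L : Type) finProdFinEquiv (frameD V) (frameD_real V) (frameD_ne V) (dW S) (dW_real S) (dW_ne S) hGR
        (cmDetTwistChar (L : Type) (frameD V) (frameD_ne V) (dW S) (dW_ne S)
          (charOfUnitaryLineChar (L : Type) χV) (charOfUnitaryLineChar (L : Type) χW))).toHomUnits := rfl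

/-- **`wm V c` v2 of record** = `wmOf' hP (wmInputCM₂b …)` (definitionally the v0 term at the named fields). -/
def wmOf₂b (hδ : 0 < (ι₁ (imagUnit L)).im) (τ : L →+* ℂ) (T : GL (Fin 3) ℂ)
    (hT : formCongr (starRingEnd ℂ) T (V.Hm.map τ) = Literature.Geometry.ComplexHyperbolic.BallModel.J) :
    WeilThetaModel (V.latticeModel hP).toQuotientModel.G (V.latticeModel hP).toQuotientModel.Γ
      (S.latticeModelW hP).toQuotientModel.G (S.latticeModelW hP).toQuotientModel.Γ :=
  wmOf' hP (wmInputCM₂b V S hGR hρ χV χW hδ τ T hT)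

/-- **Z⁻ ACCEPTANCE TEST, decidable half + socket** (model1-g4 03:36:01Z; (χ′-final): `hβ` is NOT an E binder — it
enters only here, as the hypothesis of the test): on the anti-diagonal centre `Z⁻ = {(u·1_V, u⁻¹·1_W)}` the W-action
of the block of record is the scalar `β u` as soon as `(χ_V∘det)·(χ_W∘det)` restricted to `Z⁻`, i.e.
`u ↦ χ_V(u³)·χ_W(u⁻²)`, equals `β` (value half vs Kudla's β [HKS96 (1.14)–(1.15) p. 952]: binder-2's archimedean read-off). -/
theorem wmInputCM₂b_center (β : CMAdelicOne (L : Type) →* ℂˣ)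
    (hβ : ∀ u : CMAdelicOne (L : Type),
      charOfUnitaryLineChar (L : Type) χV (u ^ 3) * charOfUnitaryLineChar (L : Type) χW (u⁻¹ ^ 2) = β u)
    (u : CMAdelicOne (L : Type)) (Φ : CMSchwartz (L : Type) 6) :
    cmPairRepTwist (L : Type) finProdFinEquiv (frameD V) (frameD_real V) (frameD_ne V) (dW S) (dW_real S) (dW_ne S) hGR
        (cmDetTwistChar (L : Type) (frameD V) (frameD_ne V) (dW S) (dW_ne S)
          (charOfUnitaryLineChar (L : Type) χV) (charOfUnitaryLineChar (L : Type) χW))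
        (CMCenter (L : Type) (frameD V) u, CMCenter (L : Type) (dW S) u⁻¹) Φ = ((β u : ℂˣ) : ℂ) • Φ :=
  cmPairRepTwist_center_of_centerCharEq (L : Type) finProdFinEquiv (frameD V) (frameD_real V) (frameD_ne V) (dW S) (dW_real S) (dW_ne S) hGR _ u
    (centerCharEq_cmDetTwistChar_of_eq (L : Type) (frameD V) (frameD_ne V) (dW S) (dW_ne S)
      (charOfUnitaryLineChar (L : Type) χV) (charOfUnitaryLineChar (L : Type) χW) β hβ) Φ

/- TERM form `unitaryLineCharOfType` / `wmInputCM₂t (nV nW) hδ τ T hT`: in the sibling leaf `HodgeCM/Model/WmInstanceV2Term.lean`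
   (imports this file + the twin `HodgeCM.Vendored.H21.NumberTheory.Automorphic.UnitaryLineCharacters`, which enters the package with
   K-1 v20 / the (J-CMη-det∞) head; split off so that this leaf never waits for it). -/

/-- **`wmInputCM` v2 with `hρ` DISCHARGED from sign facts** (node W2-wm.maj PIN half, weil-2-g5: tree
`Weil1964.hasThetaMajorants_cmPairSplitting_of_signs_two` p184270 `Weil1964/ArchDualPairThetaMajorants.lean` :862;
the sign facts `h₁V`, `hV` come from `HermSpace3` data via `LinearAlgebra/Matrix/HermitianCongruenceInertia.lean` p184479
(`exists_re_neg_of_frame_signature_units`, `re_pos_of_frame_posDef_units`), `h₁W` from `GoodCtx.forced/mem` — PKG-side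
derivations NOT booked (model2-g5 07:08:33Z: O1/O3 at K-1 install time). -/
def wmInputCM₂s
    (h₁V : ∃ i₀ : Fin 3, (∀ i, i ≠ i₀ → 0 < (ι₁ ((frameD V) i)).re) ∨ ∀ i, i ≠ i₀ → (ι₁ ((frameD V) i)).re < 0)
    (h₁W : (∀ j, 0 < (ι₁ ((dW S) j)).re) ∨ ∀ j, (ι₁ ((dW S) j)).re < 0)
    (hV : ∀ τ' : (L : Type) →+* ℂ, NumberField.InfinitePlace.mk τ' ≠ NumberField.InfinitePlace.mk ι₁ →
      (∀ i, 0 < (τ' ((frameD V) i)).re) ∨ ∀ i, (τ' ((frameD V) i)).re < 0)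
    (hδ : 0 < (ι₁ (imagUnit L)).im) (τ : L →+* ℂ) (T : GL (Fin 3) ℂ)
    (hT : formCongr (starRingEnd ℂ) T (V.Hm.map τ) = Literature.Geometry.ComplexHyperbolic.BallModel.J) : WmInput V S :=
  wmInputCM₂b V S hGR
    (hasThetaMajorants_cmPairSplitting_of_signs_two (L : Type) finProdFinEquiv (frameD V) (frameD_real V) (frameD_ne V) (dW S) (dW_real S) (dW_ne S)
      ι₁ hGR h₁V h₁W hV)
    χV χW hδ τ T hT

/-- **`wmInputCM` v2 with `hρ` discharged and the `V`-side sign facts READ OFF `HermSpace3`** (gen 5 `Signs`):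
the only remaining sign binder is `h₁W` (`W = ⟨a₀, a₁⟩` definite at `ι₁` — true under `GoodCtx`, supplied by E). By definition
this IS `wmInputCM₂b` at the `hρ` of `hasThetaMajorants_cmPairSplitting_of_signs_two`, so every `wmInputCM₂b` lemma applies
(instantiate its `hρ`; no separate API is stated here — the unifier cost of restating it is not worth a lemma). -/
def wmInputCM₂s'
    (h₁W : (∀ j, 0 < (ι₁ ((dW S) j)).re) ∨ ∀ j, (ι₁ ((dW S) j)).re < 0)
    (hδ : 0 < (ι₁ (imagUnit L)).im) (τ : L →+* ℂ) (T : GL (Fin 3) ℂ)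
    (hT : formCongr (starRingEnd ℂ) T (V.Hm.map τ) = Literature.Geometry.ComplexHyperbolic.BallModel.J) : WmInput V S :=
  wmInputCM₂b V S hGR
    (hasThetaMajorants_cmPairSplitting_of_signs_two (L : Type) finProdFinEquiv (frameD V) (frameD_real V) (frameD_ne V) (dW S) (dW_real S) (dW_ne S)
      ι₁ hGR (frameD_sign_ι₁' V) h₁W (frameD_sign_of_ne V))
    χV χW hδ τ T hT

end V2c


end HodgeCM.Model

end
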